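import Summits.ValiantsHypothesis.ValiantsHypothesis.Theorems.MonotoneRestorationMonotoneRestorationQPLinearWidthSaturation
import HarnessLib

/-!
# The width saturator vanishes at every point with a non-trivial diagonal stabiliser (line `linear_width`, GAP 1)

Route MonotoneRestoration, crux `MonotoneRestorationQP` (stmt-ValiantsHypothesis-15886), line `linear_width`
(skeleton 447dbbe2994c48fa), stub `stub_degreeLifting`; namespace `Summit.ValiantsHypothesis.ValiantsHypothesis.Theorems.WidthSaturation`.

The certified saturation remark (`polylogHomDetermined_discSq_mul`): for every matrix-symmetric `h` the product
`Disc(row sums)² · Disc(col sums)² · h` is polylog-hom-determined, so `WidthRestorationQP` restores it; GAP 1 asks to get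
back to `h`.  The orbit currency is now closed under EXACT DIVISION at a base point FIXED by the diagonal `Sym(Fin n)`
(`ValueOrbitDivision.qpOrbitRestorable_of_mul_eq_of_eval_ne_zero`, item 18293).  This file records, in the kernel, why
that tool cannot divide the saturator out:

* `rowSum_comp_eq_of_stabilizer` — if `A ∘ σ = A` (diagonal action) then the row sums of `A` are `σ`-invariant;
* `eval_discRowSq_eq_zero_of_stabilizer` — hence `Disc(row sums)²` VANISHES at every point `A ∈ ℂ^{n×n}` fixed by some
  `σ ≠ 1`; in particular (`eval_discRowSq_eq_zero_of_fixed`) at every point fixed by the whole diagonal group once `n ≥ 2`,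
  and (`eval_saturator_eq_zero_of_stabilizer`) so does the full saturator `Disc(row sums)² · Disc(col sums)² · h`;
* `stabilizer_nontrivial_of_orbit_lt` — a point whose diagonal orbit has fewer than `n!` elements is fixed by some
  `σ ≠ 1` (orbit–stabiliser), so the saturator vanishes at every point of quasi-polynomial (indeed sub-`n!`) orbit.

Consequence for the census of `stub_degreeLifting`: Strassen-type division needs a base point where the divisor is
non-zero and whose orbit is small; for the saturator no such point exists, so GAP 1 is not closed by division elimination
(consistent with the line's label "IsVPFamily must be used").  Honest label: a no-go lemma; no stub closed; VP ≠ VNP untouched.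
[folklore]
-/

noncomputable section

open scoped Classical

-- `Summit.ValiantsHypothesis.ValiantsHypothesis.…` is the tree's single-conjunct layout (Sub = Summit).
set_option linter.dupNamespace false

namespace Summit.ValiantsHypothesis.ValiantsHypothesis.Theorems

namespace WidthSaturation

open MvPolynomial Matrix

variable {n : ℕ}

/-- If `A` is fixed by the diagonal action of `σ` (`A (σ i, σ j) = A (i, j)`), its row sums are `σ`-invariant.
[folklore] -/
theorem rowSum_comp_eq_of_stabilizer (A : Fin n × Fin n → ℂ) (σ : Equiv.Perm (Fin n))
    (hA : ∀ p : Fin n × Fin n, A (σ p.1, σ p.2) = A p) (u : Fin n) :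
    ∑ j, A (σ u, j) = ∑ j, A (u, j) := by
  calc ∑ j, A (σ u, j) = ∑ j, A (σ u, σ j) := (Equiv.sum_comp σ (fun j => A (σ u, j))).symm
    _ = ∑ j, A (u, j) := Finset.sum_congr rfl fun j _ => hA (u, j)

/-- Dually for column sums. [folklore] -/
theorem colSum_comp_eq_of_stabilizer (A : Fin n × Fin n → ℂ) (σ : Equiv.Perm (Fin n))
    (hA : ∀ p : Fin n × Fin n, A (σ p.1, σ p.2) = A p) (v : Fin n) :
    ∑ i, A (i, σ v) = ∑ i, A (i, v) := by
  calc ∑ i, A (i, σ v) = ∑ i, A (σ i, σ v) := (Equiv.sum_comp σ (fun i => A (i, σ v))).symm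
    _ = ∑ i, A (i, v) := Finset.sum_congr rfl fun i _ => hA (i, v)

/-- **`Disc(row sums)²` vanishes at every point with a non-trivial diagonal stabiliser.** [folklore] -/
theorem eval_discRowSq_eq_zero_of_stabilizer (A : Fin n × Fin n → ℂ) (σ : Equiv.Perm (Fin n)) (hσ : σ ≠ 1)
    (hA : ∀ p : Fin n × Fin n, A (σ p.1, σ p.2) = A p) :
    eval A (det (vandermonde fun u : Fin n => ∑ j : Fin n, (X (u, j) : MvPolynomial (Fin n × Fin n) ℂ)) ^ 2)
      = 0 := by
  rw [eval_discRowSq_eq_zero_iff]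
  intro hinj
  apply hσ
  ext u
  have h := rowSum_comp_eq_of_stabilizer A σ hA u
  exact congrArg Fin.val (hinj h)

/-- **`Disc(col sums)²` vanishes at every point with a non-trivial diagonal stabiliser.** [folklore] -/
theorem eval_discColSq_eq_zero_of_stabilizer (A : Fin n × Fin n → ℂ) (σ : Equiv.Perm (Fin n)) (hσ : σ ≠ 1)
    (hA : ∀ p : Fin n × Fin n, A (σ p.1, σ p.2) = A p) :
    eval A (det (vandermonde fun v : Fin n => ∑ i : Fin n, (X (i, v) : MvPolynomial (Fin n × Fin n) ℂ)) ^ 2)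
      = 0 := by
  rw [eval_discColSq_eq_zero_iff]
  intro hinj
  apply hσ
  ext v
  have h := colSum_comp_eq_of_stabilizer A σ hA v
  exact congrArg Fin.val (hinj h)

/-- **The saturator `Disc(row sums)² · Disc(col sums)² · h` vanishes at every point with a non-trivial diagonal
stabiliser**, whatever `h`. [folklore] -/
theorem eval_saturator_eq_zero_of_stabilizer (h : MvPolynomial (Fin n × Fin n) ℂ) (A : Fin n × Fin n → ℂ)
    (σ : Equiv.Perm (Fin n)) (hσ : σ ≠ 1) (hA : ∀ p : Fin n × Fin n, A (σ p.1, σ p.2) = A p) :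
    eval A (det (vandermonde fun u : Fin n => ∑ j : Fin n, (X (u, j) : MvPolynomial (Fin n × Fin n) ℂ)) ^ 2 *
        det (vandermonde fun v : Fin n => ∑ i : Fin n, (X (i, v) : MvPolynomial (Fin n × Fin n) ℂ)) ^ 2 * h) = 0 := by
  rw [map_mul, map_mul, eval_discRowSq_eq_zero_of_stabilizer A σ hσ hA, zero_mul, zero_mul]

/-- For `n ≥ 2` the diagonal group is non-trivial: the transposition of `0` and `1`. [folklore] -/
theorem exists_perm_ne_one (hn : 2 ≤ n) : ∃ σ : Equiv.Perm (Fin n), σ ≠ 1 := by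
  refine ⟨Equiv.swap (⟨0, by omega⟩ : Fin n) ⟨1, by omega⟩, fun h => ?_⟩
  have := Equiv.swap_apply_left (⟨0, by omega⟩ : Fin n) ⟨1, by omega⟩
  rw [h, Equiv.Perm.one_apply, Fin.mk.injEq] at this
  exact absurd this (by norm_num)

/-- **The saturator vanishes on the whole fixed locus** (`n ≥ 2`): at every point fixed by the diagonal action of all of
`Sym(Fin n)` — the only base points at which the orbit-currency division theorem
`ValueOrbitDivision.qpOrbitRestorable_of_mul_eq_of_eval_ne_zero` applies. [folklore] -/
theorem eval_discRowSq_eq_zero_of_fixed (hn : 2 ≤ n) (A : Fin n × Fin n → ℂ)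
    (hA : ∀ (σ : Equiv.Perm (Fin n)) (p : Fin n × Fin n), A (σ p.1, σ p.2) = A p) :
    eval A (det (vandermonde fun u : Fin n => ∑ j : Fin n, (X (u, j) : MvPolynomial (Fin n × Fin n) ℂ)) ^ 2)
      = 0 := by
  obtain ⟨σ, hσ⟩ := exists_perm_ne_one hn
  exact eval_discRowSq_eq_zero_of_stabilizer A σ hσ (hA σ)

/-- **Orbit–stabiliser: a point of sub-`n!` diagonal orbit has a non-trivial stabiliser.**  If the diagonal orbit
`{A ∘ σ}` of `A` has fewer than `n!` elements, some `σ ≠ 1` fixes `A`. [folklore] -/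
theorem stabilizer_nontrivial_of_orbit_lt (A : Fin n × Fin n → ℂ)
    (hlt : (Set.range fun σ : Equiv.Perm (Fin n) => fun p : Fin n × Fin n => A (σ p.1, σ p.2)).ncard <
      n.factorial) :
    ∃ σ : Equiv.Perm (Fin n), σ ≠ 1 ∧ ∀ p : Fin n × Fin n, A (σ p.1, σ p.2) = A p := by
  by_contra hcon
  push Not at hcon
  -- then `σ ↦ A ∘ σ` is injective, so the orbit has `n!` elements
  have hinj : Function.Injective fun σ : Equiv.Perm (Fin n) => fun p : Fin n × Fin n => A (σ p.1, σ p.2) := by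
    intro σ τ hστ
    by_contra hne
    have hne' : σ * τ⁻¹ ≠ 1 := by
      intro h1; apply hne
      calc σ = (σ * τ⁻¹) * τ := by group
        _ = τ := by rw [h1, one_mul]
    obtain ⟨p, hp⟩ := hcon (σ * τ⁻¹) hne'
    apply hp
    have key := congrFun hστ (τ.symm p.1, τ.symm p.2)
    simp only [Equiv.apply_symm_apply, Prod.mk.eta] at key
    simpa [Equiv.Perm.mul_apply, Equiv.Perm.inv_def] using key
  have hcard : (Set.range fun σ : Equiv.Perm (Fin n) => fun p : Fin n × Fin n => A (σ p.1, σ p.2)).ncard =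
      n.factorial := by
    rw [Set.ncard_range_of_injective hinj, Nat.card_eq_fintype_card, Fintype.card_perm, Fintype.card_fin]
  omega

/-- **Hence the saturator vanishes at every point of sub-`n!` diagonal orbit** — in particular at every point of
quasi-polynomial orbit, the only candidates for an orbit-preserving base point. [folklore] -/
theorem eval_saturator_eq_zero_of_orbit_lt (h : MvPolynomial (Fin n × Fin n) ℂ) (A : Fin n × Fin n → ℂ)
    (hlt : (Set.range fun σ : Equiv.Perm (Fin n) => fun p : Fin n × Fin n => A (σ p.1, σ p.2)).ncard <
      n.factorial) :
    eval A (det (vandermonde fun u : Fin n => ∑ j : Fin n, (X (u, j) : MvPolynomial (Fin n × Fin n) ℂ)) ^ 2 *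
        det (vandermonde fun v : Fin n => ∑ i : Fin n, (X (i, v) : MvPolynomial (Fin n × Fin n) ℂ)) ^ 2 * h) = 0 := by
  obtain ⟨σ, hσ, hA⟩ := stabilizer_nontrivial_of_orbit_lt A hlt
  exact eval_saturator_eq_zero_of_stabilizer h A σ hσ hA

end WidthSaturation

end Summit.ValiantsHypothesis.ValiantsHypothesis.Theorems

end
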